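import Literature.MathematicalPhysics.QuantumFieldTheory.Federbush1986.LandauModePlaquetteVariables
import Literature.MathematicalPhysics.QuantumFieldTheory.Federbush1986.ModeAnalyticityThm33Corrected
import Literature.MathematicalPhysics.QuantumFieldTheory.Federbush1986.ModeEstimatesFromPartII

/-!
# `Federbush1986.CorrectedModePlaquetteVariables` — [Federbush1986PhaseCellI] §3 p. 327 «In this section (and Part II of this
# paper) we construct a potential, A^N_μ(x), satisfying Estimates 0.1–0.3, yielding the correct plaquette assignments at level 0,
# and minimizing the continuum action subject to this constraint» — FOR ONE EXPLICIT FIELD, the position-space potential of the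
# corrected-gauge mode `Â = A′ + pX_c` of [FederbushWilliamson1987PhaseCellII] (p04's `gcorr`): (3.13)–(3.15) AND (3.3) PROVED;
# hence the statement of I §0 (Estimates 0.1–0.7, `≤` reading) follows from the ONE remaining clause, constrained minimality (3.4)

statement-level skeleton of published theorems with citation tags; proofs where landed; nothing here is a claim about the Yang–Mills mass gap

CITATION HEADER.  P. Federbush, *A phase cell approach to Yang–Mills theory. I. Modes, lattice-continuum duality*, Commun.
Math. Phys. **107** (1986) 319–329 [Federbush1986PhaseCellI] (p. 327–328 READ AS IMAGES `run/shared/lean/pub/lit-balaban/lit-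
balaban-r17/renders/fedI/fed1986-cmp107-p009|p010-x2.png`); P. Federbush, C. Williamson, *… II. Analysis of a mode*, J. Math.
Phys. **28** (1987) 1416–1419 [FederbushWilliamson1987PhaseCellII] (p. 1416–1417 READ AS IMAGES `…/b2b-balaban-t4-lit2/g7/
fw1987II/fedwill1987-jmp28-II-p001|p002-x2.png`).  Unit `lit-balaban-r17` gen 11 (fold owner of the Federbush block; own lane
`Federbush1986/`), SKELETON rows **F1.Eq3.2-3.12** (cell (3.3) + the §3 sentence), **F1.Sect§0** / **F1.Est0.1-0.7** consumers
(`ModeEstimatesFromPartII`), **F2.Thm3.3**, **F2.Sect§IV**; heads unchanged.  HOME `run/shared/lean/pub/lit-balaban/`.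
Assembles: `LandauModePlaquetteVariables` (r17 gen 11: (3.3) for every integrable mode `A′ + pX`), p04's
`ModeAnalyticityCellPositivity`/`…Thms31to33Corrected`/`…Thm33Corrected` (the corrected-gauge mode `gcorr`: Theorems 3.1–3.3),
r17/p04's `ModeDecayPaleyWiener` (§IV ⇒ (3.13)–(3.15)) and `ModeEstimatesFromPartII` (Part II's deliverable ⇒ §0).

THE PRINT (verbatim).  I p. 327: *«By scaling arguments it is enough to study level 0 modes, and to prove Estimates 0.1–0.7
with L = 1. By translation invariance and linearity we may restrict our study to the single configuration of bond assignments
at level 0 having exactly one non-zero value, for a bond at the origin. … In this section (and Part II of this paper) we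
construct a potential, A^N_μ(x), satisfying Estimates 0.1–0.3, yielding the correct plaquette assignments at level 0, and
minimizing the continuum action subject to this constraint. … We thus have prescribed (χ_p, A) = β_p, p ∈ ℒ⁰. (3.3) … We seek
a minimum of the action S, for a Landau gauge A′, … S = ½∫Σ_{i,j}(∂A′_i/∂x_j)² + ½α² Σ_{p∈ℒ⁰}((χ_p, A′) − β_p)², (3.4) and then
take the limit α → ∞.»*; p. 328: *«A^N_μ(x) is the Fourier transform of A(p), where A_i(p) = A′_i(p) + p_iX(p) for a suitable
X(p) to be specified in Part II. We there show: |A^N_μ(x)| < ce^{−γ|x|}, (3.13) |DA^N_μ(x)| < ce^{−γ|x|}, (3.14) (1/|x −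
y|^{1−ε})|DA^N_μ(x) − DA^N_μ(y)| < c_εe^{−γ|x|}, (3.15)»*.  II p. 1417: *«We define A^N_i(p), a gauge transformation of A′_i(p),
by A^N_i(p) = A′_i(p) + p_iX(p), (2.4) … Theorem 3.2 (Global analyticity): A^N_i(p) is analytic in the domain, 𝒟_G, specified
by |Im p_j| < ε₀. (3.3) Theorem 3.3 (Boundedness): Within the domain, 𝒟_B, … |A^N_i(p)| < c∏_j(1/(|p_j| + 1))(1/(|p²| + 1)).
(3.5) … IV. CONCLUSIONS Equations (3.13)–(3.15) of Ref. 1 follow directly from Theorems 3.2 and 3.3 of the last section by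
standard techniques.»*

WHAT IS PROVED (kernel-checked; one `def` with body; no `Prop`-valued definition, no named fact).
* §1 `gcorr_toC_eq`: p04's global analytic representative `gcorr s i` EQUALS `A′_i + p_iX_c` (`ModeAnalyticityCorrectedGauge.ANc`)
  at EVERY real momentum with no component in `2πℤ` (every cell — p04 stated the home cell `realGeneric`); `integrable_gcorr_toC`
  (Theorem 3.3's bound ⇒ integrable, `PlaquetteGram.integrable_toC_of_bound`).
* §2 `field s := (1/2π)² Re ∫ d⁴p e^{ip·x} gcorr s` (print's Fourier convention); **`plaqFunctional_field`: (3.3) `(χ_q, A^N) =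
  β_q` at every level-0 plaquette** (`PlaquetteGram.plaqFunctional_modeField_normalised`); **`decay313to315_field`: (3.13)–(3.15)**
  (`ModeDecay.decay313to315_of_theorem33_shape`); `contDiff_field`; **`field_decay_and_plaq`**: conjuncts (1)–(2) of the hypothesis
  of `ModeEstimatesFromPartII.modeEstimatesLe_of_partII_dir` (plaquette variables in the tree's Bałaban averaging
  `axialTreeAveraging`, via `axialTreeAveraging_plaq_eq_plaqFunctional`); and **`modeEstimatesLe_of_field_minimal`: IF `field s`
  minimises the continuum action among `C¹` fields with the same level-0 plaquette variables, THEN `axialTreeAveraging.ModeEstimatesLe`**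
  (the statement of I §0, Estimates 0.1–0.7 in the `≤` reading, for every datum).

HONEST SCOPE.  (a) The mode is p04's CORRECTED-gauge mode `Â = A′ + pX_c` (`X_c = X/(1+g)`), for which Theorems 3.1–3.3 hold
(`theorems31to33_corrected`); for the printed `A^N = A′ + pX` of (2.4)–(2.5) Theorem 3.1 is refuted as typed
(`ModeAnalyticityThm31Refutation`).  Both are gauge transforms of the same Landau-gauge `A′`, so (3.3) is insensitive to the
choice (`sum_fourierFactor_mul_coord`), and so is the gauge-invariant `contAction`.  (b) NOT proved here: the third clause,
constrained minimality of the continuum action («minimizing the continuum action subject to this constraint», (3.4) with α → ∞)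
— it is the explicit hypothesis `hmin` of `modeEstimatesLe_of_field_minimal`; nothing is claimed about it.  (c) The field carries
print's factor `(1/2π)²` relative to the tree's bare `modeField` (see `LandauModePlaquetteVariables`, HONEST SCOPE (a)).  (d) One
direction (the bond «in the +1 direction», tree direction `0`) — the other three are supplied inside `modeEstimatesLe_of_partII_dir`
by coordinate permutations.  (e) `s` (the exponent of (2.5)) is arbitrary: every `s` works for the corrected mode.  Axioms standard.
-/

namespace Literature.MathematicalPhysics.QuantumFieldTheory.Federbush1986

noncomputable section

open Complex ModeAnalyticity MeasureTheory
open scoped BigOperators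

namespace CorrectedMode

open ModeDecay (toC modeFT modeField)
open ModeTranslation (unitData)
open ModeAnalyticityCorrectedGauge (ANc Xc)
open ModeAnalyticityCellPositivity (gcorr delta0 delta0_pos cellIdx mem_cellSet_cellIdx)
open ModeAnalyticityThms31to33Corrected (gcorr_eq generic_of_real ANc_eq_Grep analyticOnNhd_gcorr)
open ModeAnalyticityThm33Corrected (norm_gcorr_le norm_gcorr_lt)
open AbelianAveraging (Decay313to315)

/-! ## §1 The corrected-gauge mode at the real momenta off `2πℤ⁴` -/

/-- A real momentum lies in `𝒟_G(ε)` for every `ε > 0`. [cite: FederbushWilliamson1987PhaseCellII, (3.3) p. 1417] -/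
theorem toC_mem_DG {ε : ℝ} (hε : 0 < ε) (x : Fin 4 → ℝ) : toC x ∈ DG ε := fun j => by
  simp [toC, hε]

/-- **The global analytic representative IS `Â_i = A′_i + p_iX_c` at every real momentum with no component in `2πℤ`** (every
cell, not only the home cell `(−π, π]⁴` of `realGeneric`): the hypothesis of `PlaquetteGram.plaqFunctional_modeField`.
[cite: FederbushWilliamson1987PhaseCellII, (2.4) p. 1417, (3.1) p. 1417, Theorems 3.1–3.2 p. 1417] -/
theorem gcorr_toC_eq (s : ℕ) (i : Fin 4) {x : Fin 4 → ℝ} (hx : ∀ k (m : ℤ), x k ≠ 2 * Real.pi * m) :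
    gcorr s i (toC x) = Aprime i (toC x) + toC x i * Xc s (toC x) := by
  have hcell := mem_cellSet_cellIdx delta0_pos (toC_mem_DG delta0_pos x)
  obtain ⟨hq, hcq, hp0, hc0, h10, hf0⟩ := generic_of_real (fun j k => hx j k) (cellIdx (toC x))
  rw [gcorr_eq, ← ANc_eq_Grep s (cellIdx (toC x)) i hcell hq hcq hp0 hc0 h10 hf0]
  rfl

/-- The corrected mode is integrable over the real momenta (Theorem 3.3's bound ⇒ `c ψ₀` majorant).
[cite: FederbushWilliamson1987PhaseCellII, Theorem 3.3 (3.5) p. 1417] -/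
theorem integrable_gcorr_toC (s : ℕ) (i : Fin 4) : Integrable fun p : Fin 4 → ℝ => gcorr s i (toC p) := by
  obtain ⟨c, -, hc⟩ := norm_gcorr_le s i
  exact PlaquetteGram.integrable_toC_of_bound delta0_pos (analyticOnNhd_gcorr s i) hc

/-! ## §2 The field `A^N` of the corrected mode, print's normalisation -/

/-- **The position-space potential of the corrected-gauge mode**, in print's Fourier convention: `A^N(x) = (1/2π)² Re ∫ d⁴p
e^{ip·x} ĝ(p)`, `ĝ_i = gcorr s i` (= `A′_i + p_iX_c` at the real momenta, analytic on `𝒟_G(δ₀)`).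
[cite: Federbush1986PhaseCellI, §3 p. 327, (3.12)–(3.13) p. 328; FederbushWilliamson1987PhaseCellII, (2.4) p. 1417, §IV p. 1417] -/
def field (s : ℕ) : E4 → Fin 4 → ℝ :=
  modeField fun μ z => ((((2 * Real.pi) ^ 2)⁻¹ : ℝ) : ℂ) * gcorr s μ z

/-- **(3.3) for the corrected mode: `(χ_q, A^N) = β_q` at every level-0 plaquette** — the plaquette variables of `A^N` are those
of the unit bond at the origin in direction 0. [cite: Federbush1986PhaseCellI, (3.3) p. 327, §3 p. 327 «yielding the correct
plaquette assignments at level 0»; FederbushWilliamson1987PhaseCellII, (2.4) p. 1417] -/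
theorem plaqFunctional_field (s : ℕ) (q : Plaq 0) : plaqFunctional 0 (field s) q = plaqOfBonds (unitData 0 0) q :=
  PlaquetteGram.plaqFunctional_modeField_normalised (X := Xc s) (fun μ _ hp => gcorr_toC_eq s μ hp)
    (fun μ => integrable_gcorr_toC s μ) q

/-- **(3.13)–(3.15) for the corrected mode's field** (Paley–Wiener from Theorems 3.2–3.3, `ModeDecay`; the constant `(1/2π)²`
rides along). [cite: Federbush1986PhaseCellI, (3.13)–(3.15) p. 328; FederbushWilliamson1987PhaseCellII, §IV p. 1417] -/
theorem decay313to315_field (s : ℕ) : Decay313to315 (field s) := by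
  set k : ℝ := ((2 * Real.pi) ^ 2)⁻¹ with hk
  have hkpos : 0 < k := by rw [hk]; positivity
  have h := fun i : Fin 4 => norm_gcorr_lt s i
  choose c hc using h
  refine ModeDecay.decay313to315_of_theorem33_shape (εf := fun _ => delta0) (cf := fun i => k * c i)
    (fun _ => delta0_pos) (fun μ => ?_) (fun μ p hp => ?_)
  · exact analyticOnNhd_const.mul (analyticOnNhd_gcorr s μ)
  · have h1 := hc μ p hp
    have hP : 0 ≤ (∏ j, 1 / (‖p j‖ + 1)) * (1 / (‖csq p‖ + 1)) :=
      mul_nonneg (Finset.prod_nonneg fun j _ => by positivity) (by positivity)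
    rw [norm_mul, show ‖((k : ℝ) : ℂ)‖ = k from by rw [Complex.norm_real, Real.norm_of_nonneg hkpos.le]]
    calc k * ‖gcorr s μ p‖ < k * (c μ * (∏ j, 1 / (‖p j‖ + 1)) * (1 / (‖csq p‖ + 1))) := mul_lt_mul_of_pos_left h1 hkpos
      _ = k * c μ * (∏ j, 1 / (‖p j‖ + 1)) * (1 / (‖csq p‖ + 1)) := by ring

/-- The field is `C¹`. [cite: Federbush1986PhaseCellI, (3.13)–(3.15) p. 328] -/
theorem contDiff_field (s : ℕ) : ContDiff ℝ 1 (field s) := by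
  obtain ⟨_, _, _, _, _, h, _⟩ := decay313to315_field s
  exact h

/-- **Part II's deliverable, conjuncts (1)–(2), for ONE explicit field**: the corrected mode's potential has the decay package
(3.13)–(3.15) AND the level-0 plaquette variables (in the tree's Bałaban averaging `axialTreeAveraging`, = `(χ_p, ·)` for `C¹`
fields) of the unit bond in direction 0 — the first two of the three hypotheses of
`ModeEstimatesFromPartII.modeEstimatesLe_of_partII_dir`. [cite: Federbush1986PhaseCellI, §3 p. 327 «we construct a potential,
A^N_μ(x), satisfying Estimates 0.1–0.3, yielding the correct plaquette assignments at level 0», (3.3) p. 327, (3.13)–(3.15) p. 328] -/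
theorem field_decay_and_plaq (s : ℕ) :
    Decay313to315 (field s) ∧ ∀ p : Plaq 0, axialTreeAveraging.plaq 0 (field s) p = plaqOfBonds (unitData 0 0) p :=
  ⟨decay313to315_field s, fun p => by
    rw [axialTreeAveraging_plaq_eq_plaqFunctional (contDiff_field s) 0 p, plaqFunctional_field]⟩

/-- **ESTIMATES 0.1–0.7 (the statement of I §0, `≤` reading) FOLLOW FROM ONE REMAINING STATEMENT — the constrained minimality
(3.4)/§3 «minimizing the continuum action subject to this constraint» of the explicit field `field s`** (any `s`): given that
every `C¹` field with the same level-0 plaquette variables has at least the continuum action of `field s`, the tree's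
`axialTreeAveraging.ModeEstimatesLe` holds (via `modeEstimatesLe_of_partII_dir`: one direction suffices by coordinate
permutations; (1)–(2) are `field_decay_and_plaq`). [cite: Federbush1986PhaseCellI, §0 pp. 320–321, §3 p. 327, (3.4) p. 327, §4 pp. 328–329] -/
theorem modeEstimatesLe_of_field_minimal (s : ℕ)
    (hmin : ∀ A' : E4 → Fin 4 → ℝ, ContDiff ℝ 1 A' →
      (∀ p : Plaq 0, axialTreeAveraging.plaq 0 A' p = axialTreeAveraging.plaq 0 (field s) p) →
        contAction (field s) ≤ contAction A') :
    axialTreeAveraging.ModeEstimatesLe :=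
  ModeEstimatesFromPartII.modeEstimatesLe_of_partII_dir (μ₀ := 0)
    ⟨field s, (field_decay_and_plaq s).1, (field_decay_and_plaq s).2, hmin⟩

end CorrectedMode

end

end Literature.MathematicalPhysics.QuantumFieldTheory.Federbush1986
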